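import Literature.Analysis.FluidPDE.ForcedFourierDuhamelForcing
import Literature.Analysis.FluidPDE.ForcedFourierDuhamelForcingMeasurable
import Literature.Analysis.FluidPDE.FourierL2PicardBounds
import HarnessLib

/-!
# The forced Picard iteration in the weighted-`L²` class: the qualitative class and the uniform
# `X¹`/`X²` bounds under Tao's smallness condition

Third file of the FORCED twin of the weighted-`L²` Fourier-side construction of the local smooth
solution of the Navier–Stokes system (T. Tao, Anal. PDE 6 (2013) = arXiv:1108.1165, Thm. 5.4 (ii)
= arXiv Thm. 31 (ii), p. 18, WITH forcing: "If `(‖u₀‖_{H¹_x} + ‖f‖_{L¹_tH¹_x})⁴ T ≤ c` … then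
there exists a `H¹` mild solution", proved "by repeating the proof of Theorem 28 verbatim", i.e.
the contraction of the Duhamel map in `X¹` (p. 16): "the nonlinear map `u ↦ Φ(u)` … is a
contraction on the ball `{‖u‖_{X¹} ≤ Cδ}` if `δ⁴T ≤ c`", the ball now being centred by
`‖e^{tΔ}u₀ + ∫₀ᵗe^{(t-t')Δ}Pf‖_{X¹} ≲ ‖u₀‖_{H¹} + ‖f‖_{L¹_tH¹_x}` (Lemma 2.1 = arXiv Lemma 23,
(energy-duh2))). Homogeneous twin: `FourierL2PicardClass`, `FourierL2PicardBounds`.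

The forced iterates `w_n = picardIterForced c T a b n` (`ForcedFourierDuhamelDefs`) are written

  `w_n = h − E_n`,  `h(t) = e^{-c‖ξ‖² clamp t} a`,  `E_0 = −F`,  `E_{n+1} = duhamelIntegral c T w_n − F`,

`F = forcing c T b` the forcing term; since `F` is jointly continuous with pointwise decay of every
order (`ForcedFourierDuhamelForcing`), every `E_n` lies in the qualitative class of the
homogeneous chain and the tree's step estimates (`FourierL2DuhamelIntegrated`,
`FourierL2PicardTransfer`) apply to `v = w_n` VERBATIM; only the additive contribution of `F` to
the next iterate `w_{n+1} = (h − duhamelIntegral c T w_n) + F` is new. This file proves: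

* `class_picardIterForced'` — for the WIDE class of force coefficients (`Measurable (uncurry b)`,
  `∀ ξ, Continuous fun s => b s ξ`, uniform decay: the Leray-projected transform of a force is
  discontinuous at `ξ = 0`) the Duhamel-integral part `h + F − w_n` is jointly continuous and
  `h − w_n` is jointly measurable, continuous in time at each frequency, with pointwise decay of
  every order uniformly in time; the primed `picard_step_bounds_forced'`,
  `picard_uniform_bounds_forced'` run the recursion in this class through the primed black boxes
  of the homogeneous chain; the unprimed statements (jointly continuous `b`) are their
  specialisations;
* `class_picardIterForced` — `h − w_n` is jointly continuous with pointwise decay of every order,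
  uniformly in time, for every `n`;
* `lintegral_weight_majorant_add_sq_le`, `lintegral_time_weight_majorant_add_sq_le` — the
  elementary splits `∫(W M_{u+g})² ≤ 2∫(W M_u)² + 2∫(W M_g)²` (fixed time / time integrated);
* `picard_step_bounds_forced`, `picard_uniform_bounds_forced` — **Tao's ball preservation with
  force, Fourier side, levels 1 and 2**: with `M_n(s) = ∑ⱼ‖w_n(s)ⱼ‖ₑ` and sizes `δ₁, δ₂` dominating
  the datum moments `α_k = ∫⁻(‖η‖ᵏ∑ⱼ‖aⱼ‖ₑ)²` and the forcing moments
  (`sup_t ∫⁻(‖η‖ᵏM_F)² ≤ δ_k`, `∫₀ᵀ∫⁻(‖η‖^{k+1}M_F)² ≤ c⁻¹δ_k`), under the smallness condition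
  `36864 · C_N²K₃² · c⁻¹ (T/c)^{1/2} · δ₁ ≤ 1` (i.e. `T δ₁² ≤ c₀ c³`: Tao's
  `(‖u₀‖_{H¹} + ‖f‖_{L¹_tH¹_x})⁴ T ≤ c` after rescaling) every iterate obeys
  `sup_{[0,T]}∫⁻(‖η‖M_n)² ≤ 8δ₁`, `∫₀ᵀ∫⁻(‖η‖²M_n)² ≤ 8c⁻¹δ₁`, `sup∫⁻(‖η‖²M_n)² ≤ 8δ₂`,
  `∫₀ᵀ∫⁻(‖η‖³M_n)² ≤ 8c⁻¹δ₂` (`‖w_n‖_{X¹} ≲ ‖u₀‖_{Ḣ¹} + ‖f‖`, `‖w_n‖_{X²}` linearly, uniformly in `n`).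

No definitions, no named facts; constants written out (`C_N = 4π·9`, `K₃ = (K_{GNS}·2π)^{3/2}`).

## Mathlib / tree search

Tree (reused as black boxes): `class_duhamelIntegral`, `lintegral_weight_majorant_sub_sq_le`,
`aestronglyMeasurable_hsub_slice`, `aestronglyMeasurable_uncurry_hsub` (`FourierL2PicardClass`),
`lintegral_sq_weight_Phi_hsub_le`, `lintegral_fourth_weight_Phi_hsub_le`,
`lintegral_time_weight_majorant_heat_sq_le`, `lintegral_weight_majorant_heat_sq_le`
(`FourierL2PicardBounds`), `sup_weight_majorant_next_sq_le`, `lintegral_time_weight_majorant_next_sq_le`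
(`FourierL2PicardTransfer`), `aemeasurable_lintegral_weight_majorant_sq` (`FourierL2DuhamelIntegrated`),
the forcing-term class `continuous_forcing`, `exists_hasDecay_forcing` (`ForcedFourierDuhamelForcing`).

## References

* T. Tao, Anal. PDE 6 (2013) = arXiv:1108.1165, Thm. 5.4 (ii) = arXiv Thm. 31 (p. 18), proof of
  Thm. 5.1 = arXiv Thm. 28 (p. 16), Lemma 2.1 = arXiv Lemma 23 (p. 10). [Tao2011]
* J. Leray, Acta Math. 63 (1934), §19 (successive approximations). [Leray1934]
-/

noncomputable section

open MeasureTheory Real Set Filter Function intervalIntegral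
open scoped ENNReal NNReal
open _root_.Topology

namespace Literature.Analysis.FluidPDE.FourierNS

/-! ### The class of the forced Picard iterates -/

section Class

variable {ι : Type*} [Fintype ι] [DecidableEq ι]
variable {c T : ℝ} {a : EuclideanSpace ℝ ι → ι → ℂ} {b : ℝ → EuclideanSpace ℝ ι → ι → ℂ}

/-- **The class of every forced Picard iterate.** For `c, T ≥ 0`, a measurable datum `a` with all
weighted square moments finite and force coefficients `b` jointly continuous with pointwise decay of
every order uniformly in time, `E_n = h − w_n` (`w_n = picardIterForced c T a b n`,
`h(t) = heat(clamp t) • a`) is jointly continuous with pointwise polynomial decay of every order,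
uniformly in time (`E_0 = −F`, `E_{n+1} = duhamelIntegral c T w_n − F`; `class_duhamelIntegral` and
the class of the forcing term). [cite: Tao2011, Thm. 5.4 (ii)+(iv) (arXiv Thm. 31)] -/
theorem class_picardIterForced (hc : 0 ≤ c) (hT : 0 ≤ T) (ha : AEStronglyMeasurable a volume)
    (haw : ∀ (k : ℕ) j, ∫⁻ η, (ENNReal.ofReal ((1 + ‖η‖) ^ k) * ‖a η j‖ₑ) ^ 2 < ⊤)
    (hbc : Continuous (uncurry b)) (hbd : ∀ K : ℕ, ∃ B : ℝ, ∀ s, HasDecay K B (b s)) (n : ℕ) :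
    Continuous (uncurry fun t ξ => heat c ξ (clamp T t) • a ξ - picardIterForced c T a b n t ξ) ∧
      ∀ K : ℕ, ∃ B : ℝ, ∀ t,
        HasDecay K B (fun ξ => heat c ξ (clamp T t) • a ξ - picardIterForced c T a b n t ξ) := by
  induction n with
  | zero =>
    have h0 : ∀ t ξ, heat c ξ (clamp T t) • a ξ - picardIterForced c T a b 0 t ξ =
        -forcing c T b t ξ := fun t ξ => by
      simp only [picardIterForced_zero]
      exact sub_add_cancel_left _ _
    refine ⟨?_, fun K => ?_⟩
    · have heq : (uncurry fun t ξ => heat c ξ (clamp T t) • a ξ - picardIterForced c T a b 0 t ξ) =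
          fun p => -uncurry (forcing c T b) p := by
        funext p; exact h0 p.1 p.2
      rw [heq]; exact (continuous_forcing hbc).neg
    · obtain ⟨B, hB⟩ := exists_hasDecay_forcing (c := c) hc hT hbd K
      refine ⟨B, fun t ξ => ?_⟩
      dsimp only
      rw [h0]
      simpa using (hB t).neg ξ
  | succ n ih =>
    set En : ℝ → EuclideanSpace ℝ ι → ι → ℂ :=
      fun t ξ => heat c ξ (clamp T t) • a ξ - picardIterForced c T a b n t ξ with hEn
    have hvn : (fun s η => heat c η (clamp T s) • a η - En s η) = picardIterForced c T a b n := by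
      funext s η; simp [hEn]
    have hstep : ∀ t ξ, heat c ξ (clamp T t) • a ξ - picardIterForced c T a b (n + 1) t ξ =
        duhamelIntegral c T (fun s η => heat c η (clamp T s) • a η - En s η) t ξ -
          forcing c T b t ξ := by
      intro t ξ
      rw [hvn, picardIterForced_succ, duhamelForced_eq_sub]
      abel
    obtain ⟨hcont, hdec⟩ := class_duhamelIntegral hc hT ha haw ih.1 ih.2
    refine ⟨?_, fun K => ?_⟩
    · have heq : (uncurry fun t ξ => heat c ξ (clamp T t) • a ξ -
          picardIterForced c T a b (n + 1) t ξ) = fun p =>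
          uncurry (duhamelIntegral c T (fun s η => heat c η (clamp T s) • a η - En s η)) p -
            uncurry (forcing c T b) p := by
        funext p; exact hstep p.1 p.2
      rw [heq]; exact hcont.sub (continuous_forcing hbc)
    · obtain ⟨B₁, hB₁⟩ := hdec K
      obtain ⟨B₂, hB₂⟩ := exists_hasDecay_forcing (c := c) hc hT hbd K
      refine ⟨B₁ + B₂, fun t ξ => ?_⟩
      dsimp only
      rw [hstep]
      exact ((hB₁ t).sub (hB₂ t)) ξ

/-- **The class of every forced Picard iterate for the WIDE class of force coefficients** (jointly
measurable, continuous in time at each frequency, pointwise decay of every order uniformly in time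
— the class of the Leray-projected transform of a Schwartz force, which is discontinuous at
`ξ = 0`). Writing `w_n = h + F − D_n` (`h(t) = heat(clamp t) • a`, `F = forcing c T b`, `D_0 = 0`,
`D_{n+1} = duhamelIntegral c T w_n`): the Duhamel-integral part `D_n = h + F − w_n` is JOINTLY
CONTINUOUS, while `E_n = h − w_n = D_n − F` is jointly measurable, continuous in time at each
frequency, with pointwise decay of every order uniformly in time — exactly the wide class of the
primed black boxes of `FourierL2PicardClass/Transfer/Bounds/Envelope/Weighted/Difference`
(`class_duhamelIntegral'`). [cite: Tao2011, Thm. 5.4 (ii)+(iv) (arXiv Thm. 31)] -/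
theorem class_picardIterForced' (hc : 0 ≤ c) (hT : 0 ≤ T) (ha : AEStronglyMeasurable a volume)
    (haw : ∀ (k : ℕ) j, ∫⁻ η, (ENNReal.ofReal ((1 + ‖η‖) ^ k) * ‖a η j‖ₑ) ^ 2 < ⊤)
    (hbm : Measurable (uncurry b)) (hbt : ∀ ξ, Continuous fun s => b s ξ)
    (hbd : ∀ K : ℕ, ∃ B : ℝ, ∀ s, HasDecay K B (b s)) (n : ℕ) :
    Continuous (uncurry fun t ξ =>
        heat c ξ (clamp T t) • a ξ + forcing c T b t ξ - picardIterForced c T a b n t ξ) ∧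
      Measurable (uncurry fun t ξ => heat c ξ (clamp T t) • a ξ - picardIterForced c T a b n t ξ) ∧
      (∀ η, Continuous fun t => heat c η (clamp T t) • a η - picardIterForced c T a b n t η) ∧
      ∀ K : ℕ, ∃ B : ℝ, ∀ t,
        HasDecay K B (fun ξ => heat c ξ (clamp T t) • a ξ - picardIterForced c T a b n t ξ) := by
  have hFm : Measurable (uncurry (forcing c T b)) := measurable_uncurry_forcing' hbm
  have hFt : ∀ η, Continuous fun t => forcing c T b t η := continuous_forcing_time' hbt
  induction n with
  | zero =>
    have h0 : ∀ t ξ, heat c ξ (clamp T t) • a ξ - picardIterForced c T a b 0 t ξ =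
        -forcing c T b t ξ := fun t ξ => by
      simp only [picardIterForced_zero]
      exact sub_add_cancel_left _ _
    have hD0 : (uncurry fun t ξ =>
        heat c ξ (clamp T t) • a ξ + forcing c T b t ξ - picardIterForced c T a b 0 t ξ) =
        fun _ => 0 := by
      funext p; simp [picardIterForced_zero, uncurry]
    have heq : (uncurry fun t ξ => heat c ξ (clamp T t) • a ξ - picardIterForced c T a b 0 t ξ) =
        fun p => -uncurry (forcing c T b) p := by
      funext p; exact h0 p.1 p.2
    refine ⟨by rw [hD0]; exact continuous_const, by rw [heq]; exact hFm.neg, fun η => ?_, fun K => ?_⟩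
    · have : (fun t => heat c η (clamp T t) • a η - picardIterForced c T a b 0 t η) =
          fun t => -forcing c T b t η := funext fun t => h0 t η
      rw [this]; exact (hFt η).neg
    · obtain ⟨B, hB⟩ := exists_hasDecay_forcing (c := c) hc hT hbd K
      refine ⟨B, fun t ξ => ?_⟩
      dsimp only
      rw [h0]
      simpa using (hB t).neg ξ
  | succ n ih =>
    obtain ⟨-, hEm, hEt, hEd⟩ := ih
    set En : ℝ → EuclideanSpace ℝ ι → ι → ℂ :=
      fun t ξ => heat c ξ (clamp T t) • a ξ - picardIterForced c T a b n t ξ with hEn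
    have hvn : (fun s η => heat c η (clamp T s) • a η - En s η) = picardIterForced c T a b n := by
      funext s η; simp [hEn]
    have hstepD : ∀ t ξ, heat c ξ (clamp T t) • a ξ + forcing c T b t ξ -
        picardIterForced c T a b (n + 1) t ξ =
        duhamelIntegral c T (fun s η => heat c η (clamp T s) • a η - En s η) t ξ := by
      intro t ξ
      rw [hvn, picardIterForced_succ, duhamelForced_eq_sub]
      abel
    have hstep : ∀ t ξ, heat c ξ (clamp T t) • a ξ - picardIterForced c T a b (n + 1) t ξ =
        duhamelIntegral c T (fun s η => heat c η (clamp T s) • a η - En s η) t ξ -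
          forcing c T b t ξ := by
      intro t ξ
      rw [hvn, picardIterForced_succ, duhamelForced_eq_sub]
      abel
    obtain ⟨hcont, hdec⟩ := class_duhamelIntegral' hc hT ha haw hEm hEt hEd
    have heqD : (uncurry fun t ξ => heat c ξ (clamp T t) • a ξ + forcing c T b t ξ -
        picardIterForced c T a b (n + 1) t ξ) =
        uncurry (duhamelIntegral c T (fun s η => heat c η (clamp T s) • a η - En s η)) := by
      funext p; exact hstepD p.1 p.2
    have heq : (uncurry fun t ξ => heat c ξ (clamp T t) • a ξ -
        picardIterForced c T a b (n + 1) t ξ) = fun p =>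
        uncurry (duhamelIntegral c T (fun s η => heat c η (clamp T s) • a η - En s η)) p -
          uncurry (forcing c T b) p := by
      funext p; exact hstep p.1 p.2
    refine ⟨by rw [heqD]; exact hcont, by rw [heq]; exact hcont.measurable.sub hFm, fun η => ?_,
      fun K => ?_⟩
    · have : (fun t => heat c η (clamp T t) • a η - picardIterForced c T a b (n + 1) t η) =
          fun t => duhamelIntegral c T (fun s ζ => heat c ζ (clamp T s) • a ζ - En s ζ) t η -
            forcing c T b t η := funext fun t => hstep t η
      rw [this]; exact (hcont.uncurry_right η).sub (hFt η)
    · obtain ⟨B₁, hB₁⟩ := hdec K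
      obtain ⟨B₂, hB₂⟩ := exists_hasDecay_forcing (c := c) hc hT hbd K
      refine ⟨B₁ + B₂, fun t ξ => ?_⟩
      dsimp only
      rw [hstep]
      exact ((hB₁ t).sub (hB₂ t)) ξ

end Class

/-! ### Splitting the majorant of a sum -/

section Split

variable {ι : Type*} [Fintype ι]

/-- `(x + y)² ≤ 2x² + 2y²` in `ℝ≥0∞`. [folklore] -/
private theorem add_sq_le' (x y : ℝ≥0∞) : (x + y) ^ 2 ≤ 2 * x ^ 2 + 2 * y ^ 2 := by
  have h := ENNReal.rpow_add_le_mul_rpow_add_rpow x y (p := 2) (by norm_num)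
  norm_num at h
  rw [← mul_add]
  exact_mod_cast h

/-- **Weighted square moments of a sum**:
`∫⁻ (W ∑ⱼ‖(u + g) η j‖ₑ)² ≤ 2∫⁻ (W ∑ⱼ‖u η j‖ₑ)² + 2∫⁻ (W ∑ⱼ‖g η j‖ₑ)²` (`u` measurable).
[cite: Tao2011, Lemma 2.1 (arXiv Lemma 23), (energy-duh2)] -/
theorem lintegral_weight_majorant_add_sq_le {u g : EuclideanSpace ℝ ι → ι → ℂ}
    (hu : AEStronglyMeasurable u volume) {W : EuclideanSpace ℝ ι → ℝ≥0∞} (hW : Measurable W) :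
    ∫⁻ η, (W η * ∑ j, ‖(u η + g η) j‖ₑ) ^ 2 ≤
      2 * (∫⁻ η, (W η * ∑ j, ‖u η j‖ₑ) ^ 2) + 2 * (∫⁻ η, (W η * ∑ j, ‖g η j‖ₑ) ^ 2) := by
  calc ∫⁻ η, (W η * ∑ j, ‖(u η + g η) j‖ₑ) ^ 2
      ≤ ∫⁻ η, (2 * (W η * ∑ j, ‖u η j‖ₑ) ^ 2 + 2 * (W η * ∑ j, ‖g η j‖ₑ) ^ 2) := by
        refine lintegral_mono fun η => ?_
        have hpt : (∑ j, ‖(u η + g η) j‖ₑ) ≤ (∑ j, ‖u η j‖ₑ) + ∑ j, ‖g η j‖ₑ := by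
          rw [← Finset.sum_add_distrib]
          exact Finset.sum_le_sum fun j _ => by rw [Pi.add_apply]; exact enorm_add_le _ _
        calc (W η * ∑ j, ‖(u η + g η) j‖ₑ) ^ 2
            ≤ (W η * ((∑ j, ‖u η j‖ₑ) + ∑ j, ‖g η j‖ₑ)) ^ 2 := by gcongr
          _ = (W η * ∑ j, ‖u η j‖ₑ + W η * ∑ j, ‖g η j‖ₑ) ^ 2 := by rw [mul_add]
          _ ≤ _ := add_sq_le' _ _
    _ = 2 * (∫⁻ η, (W η * ∑ j, ‖u η j‖ₑ) ^ 2) + 2 * (∫⁻ η, (W η * ∑ j, ‖g η j‖ₑ) ^ 2) := by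
        rw [← lintegral_const_mul' _ _ (by norm_num), ← lintegral_const_mul' _ _ (by norm_num)]
        exact lintegral_add_left' (((hW.aemeasurable.mul (aemeasurable_majorant hu)).pow_const 2
          ).const_mul 2) _

/-- **Time-integrated weighted square moments of a sum**:
`∫₀ᵀ∫⁻ (W M_{u+g})² ≤ 2∫₀ᵀ∫⁻ (W M_u)² + 2∫₀ᵀ∫⁻ (W M_g)²` (`u` jointly measurable with measurable
slices). [cite: Tao2011, Lemma 2.1 (arXiv Lemma 23), (energy-duh2)] -/
theorem lintegral_time_weight_majorant_add_sq_le {T : ℝ} {u g : ℝ → EuclideanSpace ℝ ι → ι → ℂ}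
    (huj : AEStronglyMeasurable (uncurry u) (volume.prod volume))
    (hus : ∀ s, AEStronglyMeasurable (u s) volume) {W : EuclideanSpace ℝ ι → ℝ≥0∞}
    (hW : Measurable W) :
    ∫⁻ s in Ioc 0 T, ∫⁻ η, (W η * ∑ j, ‖(u s η + g s η) j‖ₑ) ^ 2 ≤
      2 * (∫⁻ s in Ioc 0 T, ∫⁻ η, (W η * ∑ j, ‖u s η j‖ₑ) ^ 2) +
        2 * (∫⁻ s in Ioc 0 T, ∫⁻ η, (W η * ∑ j, ‖g s η j‖ₑ) ^ 2) := by
  calc ∫⁻ s in Ioc 0 T, ∫⁻ η, (W η * ∑ j, ‖(u s η + g s η) j‖ₑ) ^ 2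
      ≤ ∫⁻ s in Ioc 0 T, (2 * (∫⁻ η, (W η * ∑ j, ‖u s η j‖ₑ) ^ 2) +
          2 * (∫⁻ η, (W η * ∑ j, ‖g s η j‖ₑ) ^ 2)) :=
        lintegral_mono fun s => lintegral_weight_majorant_add_sq_le (hus s) hW
    _ = 2 * (∫⁻ s in Ioc 0 T, ∫⁻ η, (W η * ∑ j, ‖u s η j‖ₑ) ^ 2) +
          2 * (∫⁻ s in Ioc 0 T, ∫⁻ η, (W η * ∑ j, ‖g s η j‖ₑ) ^ 2) := by
        rw [← lintegral_const_mul' _ _ (by norm_num), ← lintegral_const_mul' _ _ (by norm_num)]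
        exact lintegral_add_left' (((aemeasurable_lintegral_weight_majorant_sq huj hW).const_mul 2
          ).restrict) _

end Split

/-! ### The forced `X¹/X²` recursion (dimension three) -/

section Bounds

variable {c T : ℝ} {a : EuclideanSpace ℝ (Fin 3) → Fin 3 → ℂ}
  {b : ℝ → EuclideanSpace ℝ (Fin 3) → Fin 3 → ℂ}
  {E : ℝ → EuclideanSpace ℝ (Fin 3) → Fin 3 → ℂ}

/-- `(x²)^{1/2} = x` in `ℝ≥0∞`. [folklore] -/
private theorem rpow_half_sq' (x : ℝ≥0∞) : (x ^ 2) ^ (1 / 2 : ℝ) = x := by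
  rw [← ENNReal.rpow_natCast, ← ENNReal.rpow_mul]; norm_num

/-- The square-root bookkeeping of the step: `(8δ)^{1/2} · (T · (8c⁻¹δ'))^{1/2} = 8 θ (δδ')^{1/2}`-type
identity in the special form used below:
`(8x)^{1/2} (T' (8 c' y))^{1/2} = 8 (T' c')^{1/2} (x y)^{1/2}`. [folklore] -/
private theorem sqrt_bookkeeping (x y T' c' : ℝ≥0∞) :
    (8 * x) ^ (1 / 2 : ℝ) * (T' * (8 * c' * y)) ^ (1 / 2 : ℝ) =
      8 * (T' * c') ^ (1 / 2 : ℝ) * (x * y) ^ (1 / 2 : ℝ) := by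
  rw [← ENNReal.mul_rpow_of_nonneg _ _ (by norm_num : (0 : ℝ) ≤ 1 / 2),
    show 8 * x * (T' * (8 * c' * y)) = 8 ^ 2 * ((T' * c') * (x * y)) by ring,
    ENNReal.mul_rpow_of_nonneg _ _ (by norm_num : (0 : ℝ) ≤ 1 / 2), rpow_half_sq',
    ENNReal.mul_rpow_of_nonneg _ _ (by norm_num : (0 : ℝ) ≤ 1 / 2), mul_assoc]

/-- `(x·x)^{1/2} = x`. [folklore] -/
private theorem rpow_half_mul_self' (x : ℝ≥0∞) : (x * x) ^ (1 / 2 : ℝ) = x := by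
  rw [← sq, rpow_half_sq']

/-- **The induction step of Tao's `X¹/X²` contraction bounds WITH FORCE (Fourier side).** Let
`c > 0`, `T ≥ 0`, `a` a measurable datum with all weighted square moments finite, `E` of the
class, `v = h − E` (the current forced iterate) and `F = forcing c T b`. Let `δ₁, δ₂` dominate the datum moments (`α_k = ∫⁻(‖η‖ᵏ∑ⱼ‖aⱼ‖ₑ)² ≤ δ_k`) and the
forcing moments (`sup_{[0,T]}∫⁻(‖η‖ᵏM_F)² ≤ δ_k`, `∫₀ᵀ∫⁻(‖η‖^{k+1}M_F)² ≤ c⁻¹δ_k`, `k = 1, 2`), assume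
the smallness condition `36864 C_N²K₃² c⁻¹ (T c⁻¹)^{1/2} δ₁ ≤ 1` and the four bounds

  `sup_{[0,T]}∫⁻(‖η‖M_v)² ≤ 8δ₁`, `∫₀ᵀ∫⁻(‖η‖²M_v)² ≤ 8c⁻¹δ₁`,
  `sup_{[0,T]}∫⁻(‖η‖²M_v)² ≤ 8δ₂`, `∫₀ᵀ∫⁻(‖η‖³M_v)² ≤ 8c⁻¹δ₂`.

Then the next forced iterate `w' = (h − duhamelIntegral c T v) + F` obeys the same four bounds
(`I₁ ≤ 256C_N²K₃²(Tc⁻¹)^{1/2}δ₁²`, `I₂ ≤ 1024C_N²K₃²(Tc⁻¹)^{1/2}δ₁δ₂`, the transfer bounds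
`2α + 18(2c)⁻¹I`, `c⁻¹α + 18c⁻²I` of the homogeneous chain and the splits against `F`). This is the
ball-preservation half of the contraction argument of the proof of Thm. 5.1 (arXiv Thm. 28, p. 16)
for the Duhamel map WITH force, levels 1 and 2.
[cite: Tao2011, Thm. 5.4 (ii) (arXiv Thm. 31); proof of Thm. 5.1 (arXiv Thm. 28, p. 16); Lemma 2.1 (arXiv Lemma 23)]
Twin for the wide (jointly measurable, time-continuous at each frequency) class of `E`. -/
theorem picard_step_bounds_forced' (hc : 0 < c) (hT : 0 ≤ T) (ha : AEStronglyMeasurable a volume)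
    (haw : ∀ (k : ℕ) j, ∫⁻ η, (ENNReal.ofReal ((1 + ‖η‖) ^ k) * ‖a η j‖ₑ) ^ 2 < ⊤)
    (hEm : Measurable (uncurry E)) (hEt : ∀ η, Continuous fun s => E s η)
    (hEd : ∀ K : ℕ, ∃ B : ℝ, ∀ t, HasDecay K B (E t))
    {δ₁ δ₂ : ℝ≥0∞}
    (hα₁ : ∫⁻ η, (ENNReal.ofReal ‖η‖ * ∑ j, ‖a η j‖ₑ) ^ 2 ≤ δ₁)
    (hα₂ : ∫⁻ η, (ENNReal.ofReal (‖η‖ ^ 2) * ∑ j, ‖a η j‖ₑ) ^ 2 ≤ δ₂)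
    (hF₁ : ∀ t ∈ Icc 0 T, ∫⁻ η, (ENNReal.ofReal ‖η‖ * ∑ j, ‖forcing c T b t η j‖ₑ) ^ 2 ≤ δ₁)
    (hG₁ : ∫⁻ t in Ioc 0 T, ∫⁻ η, (ENNReal.ofReal (‖η‖ ^ 2) *
      ∑ j, ‖forcing c T b t η j‖ₑ) ^ 2 ≤ ENNReal.ofReal c⁻¹ * δ₁)
    (hF₂ : ∀ t ∈ Icc 0 T, ∫⁻ η, (ENNReal.ofReal (‖η‖ ^ 2) * ∑ j, ‖forcing c T b t η j‖ₑ) ^ 2 ≤ δ₂)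
    (hG₂ : ∫⁻ t in Ioc 0 T, ∫⁻ η, (ENNReal.ofReal (‖η‖ ^ 3) *
      ∑ j, ‖forcing c T b t η j‖ₑ) ^ 2 ≤ ENNReal.ofReal c⁻¹ * δ₂)
    (hs : 36864 * (ENNReal.ofReal (4 * π) * (Fintype.card (Fin 3) : ℝ≥0∞) ^ 2) ^ 2 *
        ((SNormLESNormFDerivOfEqConst ℂ (volume : Measure (EuclideanSpace ℝ (Fin 3))) 2 *
          ENNReal.ofReal (2 * π)) ^ (3 / 2 : ℝ)) ^ 2 * ENNReal.ofReal c⁻¹ *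
        (ENNReal.ofReal T * ENNReal.ofReal c⁻¹) ^ (1 / 2 : ℝ) * δ₁ ≤ 1)
    (hA : ∀ s ∈ Icc 0 T, ∫⁻ η, (ENNReal.ofReal ‖η‖ *
      ∑ j, ‖(heat c η (clamp T s) • a η - E s η) j‖ₑ) ^ 2 ≤ 8 * δ₁)
    (hP : ∫⁻ s in Ioc 0 T, ∫⁻ η, (ENNReal.ofReal (‖η‖ ^ 2) *
      ∑ j, ‖(heat c η (clamp T s) • a η - E s η) j‖ₑ) ^ 2 ≤ 8 * ENNReal.ofReal c⁻¹ * δ₁)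
    (hB : ∀ s ∈ Icc 0 T, ∫⁻ η, (ENNReal.ofReal (‖η‖ ^ 2) *
      ∑ j, ‖(heat c η (clamp T s) • a η - E s η) j‖ₑ) ^ 2 ≤ 8 * δ₂)
    (hE : ∫⁻ s in Ioc 0 T, ∫⁻ η, (ENNReal.ofReal (‖η‖ ^ 3) *
      ∑ j, ‖(heat c η (clamp T s) • a η - E s η) j‖ₑ) ^ 2 ≤ 8 * ENNReal.ofReal c⁻¹ * δ₂) :
    (∀ t ∈ Icc 0 T, ∫⁻ η, (ENNReal.ofReal ‖η‖ * ∑ j, ‖((heat c η (clamp T t) • a η -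
        duhamelIntegral c T (fun s ζ => heat c ζ (clamp T s) • a ζ - E s ζ) t η) +
        forcing c T b t η) j‖ₑ) ^ 2 ≤ 8 * δ₁) ∧
    (∫⁻ t in Ioc 0 T, ∫⁻ η, (ENNReal.ofReal (‖η‖ ^ 2) * ∑ j, ‖((heat c η (clamp T t) • a η -
        duhamelIntegral c T (fun s ζ => heat c ζ (clamp T s) • a ζ - E s ζ) t η) +
        forcing c T b t η) j‖ₑ) ^ 2 ≤ 8 * ENNReal.ofReal c⁻¹ * δ₁) ∧
    (∀ t ∈ Icc 0 T, ∫⁻ η, (ENNReal.ofReal (‖η‖ ^ 2) * ∑ j, ‖((heat c η (clamp T t) • a η -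
        duhamelIntegral c T (fun s ζ => heat c ζ (clamp T s) • a ζ - E s ζ) t η) +
        forcing c T b t η) j‖ₑ) ^ 2 ≤ 8 * δ₂) ∧
    (∫⁻ t in Ioc 0 T, ∫⁻ η, (ENNReal.ofReal (‖η‖ ^ 3) * ∑ j, ‖((heat c η (clamp T t) • a η -
        duhamelIntegral c T (fun s ζ => heat c ζ (clamp T s) • a ζ - E s ζ) t η) +
        forcing c T b t η) j‖ₑ) ^ 2 ≤ 8 * ENNReal.ofReal c⁻¹ * δ₂) := by
  -- the bilinear quantities of `v`
  have hI₁ := lintegral_sq_weight_Phi_hsub_le' hc ha haw hEm hEt hEd hA hP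
  have hI₂ := lintegral_fourth_weight_Phi_hsub_le' hc ha haw hEm hEt hEd hA hB hE
  -- the four transfer bounds (raw form) for `v' = h - duhamelIntegral c T v`
  have hTA := fun t (ht : t ∈ Icc 0 T) => sup_weight_majorant_next_sq_le' (T := T) hc ha haw hEm hEt hEd 1
    ((lintegral_congr fun ξ => by norm_num).trans_le hI₁) ht
  have hTP := lintegral_time_weight_majorant_next_sq_le' hc hT ha haw hEm hEt hEd 0
    ((lintegral_congr fun ξ => by norm_num).trans_le hI₁)
  have hTB := fun t (ht : t ∈ Icc 0 T) => sup_weight_majorant_next_sq_le' (T := T) hc ha haw hEm hEt hEd 2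
    ((lintegral_congr fun ξ => by norm_num).trans_le hI₂) ht
  have hTE := lintegral_time_weight_majorant_next_sq_le' hc hT ha haw hEm hEt hEd 1
    ((lintegral_congr fun ξ => by norm_num).trans_le hI₂)
  simp only [pow_one] at hTA
  simp only [zero_add, pow_one] at hTP
  simp only [show (1 : ℕ) + 2 = 3 from rfl, show (1 : ℕ) + 1 = 2 from rfl] at hTE
  -- the next homogeneous iterate `v'` and its measurability
  set v : ℝ → EuclideanSpace ℝ (Fin 3) → Fin 3 → ℂ :=
    fun s η => heat c η (clamp T s) • a η - E s η with hv
  set E' : ℝ → EuclideanSpace ℝ (Fin 3) → Fin 3 → ℂ := duhamelIntegral c T v with hE'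
  obtain ⟨hE'c, -⟩ := class_duhamelIntegral' hc.le hT ha haw hEm hEt hEd
  have hv's : ∀ t, AEStronglyMeasurable (fun η => heat c η (clamp T t) • a η - E' t η) volume :=
    aestronglyMeasurable_hsub_slice c T a E' ha hE'c
  have hv'j : AEStronglyMeasurable (uncurry fun t η => heat c η (clamp T t) • a η - E' t η)
      (volume.prod volume) := aestronglyMeasurable_uncurry_hsub c T a E' ha hE'c
  have hW1 : Measurable fun η : EuclideanSpace ℝ (Fin 3) => ENNReal.ofReal ‖η‖ :=
    (ENNReal.continuous_ofReal.comp continuous_norm).measurable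
  have hWk : ∀ k : ℕ, Measurable fun η : EuclideanSpace ℝ (Fin 3) => ENNReal.ofReal (‖η‖ ^ k) :=
    fun k => (ENNReal.continuous_ofReal.comp (continuous_norm.pow k)).measurable
  -- the splits against the forcing term
  have hSA := fun t (_ : t ∈ Icc 0 T) => lintegral_weight_majorant_add_sq_le
    (g := forcing c T b t) (hv's t) hW1
  have hSB := fun t (_ : t ∈ Icc 0 T) => lintegral_weight_majorant_add_sq_le
    (g := forcing c T b t) (hv's t) (hWk 2)
  have hSP := lintegral_time_weight_majorant_add_sq_le (T := T) (g := forcing c T b) hv'j hv's (hWk 2)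
  have hSE := lintegral_time_weight_majorant_add_sq_le (T := T) (g := forcing c T b) hv'j hv's (hWk 3)
  -- abbreviations
  set C : ℝ≥0∞ := ENNReal.ofReal (4 * π) * (Fintype.card (Fin 3) : ℝ≥0∞) ^ 2 with hC
  set K3 : ℝ≥0∞ := (SNormLESNormFDerivOfEqConst ℂ (volume : Measure (EuclideanSpace ℝ (Fin 3))) 2 *
    ENNReal.ofReal (2 * π)) ^ (3 / 2 : ℝ) with hK3
  set α₁ : ℝ≥0∞ := ∫⁻ η, (ENNReal.ofReal ‖η‖ * ∑ j, ‖a η j‖ₑ) ^ 2 with hα₁_def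
  set α₂ : ℝ≥0∞ := ∫⁻ η, (ENNReal.ofReal (‖η‖ ^ 2) * ∑ j, ‖a η j‖ₑ) ^ 2 with hα₂_def
  set θ : ℝ≥0∞ := (ENNReal.ofReal T * ENNReal.ofReal c⁻¹) ^ (1 / 2 : ℝ) with hθ
  set κ : ℝ≥0∞ := C ^ 2 * K3 ^ 2 * ENNReal.ofReal c⁻¹ * θ * δ₁ with hκ
  have hs' : 36864 * κ ≤ 1 := by
    calc 36864 * κ = 36864 * C ^ 2 * K3 ^ 2 * ENNReal.ofReal c⁻¹ * θ * δ₁ := by rw [hκ]; ring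
      _ ≤ 1 := hs
  -- numeric identities for the bilinear quantities
  have hI₁' : (8 * δ₁) ^ (1 / 2 : ℝ) * (8 * δ₁) *
      (ENNReal.ofReal T * (8 * ENNReal.ofReal c⁻¹ * δ₁)) ^ (1 / 2 : ℝ) = 64 * θ * δ₁ ^ 2 := by
    calc (8 * δ₁) ^ (1 / 2 : ℝ) * (8 * δ₁) * (ENNReal.ofReal T * (8 * ENNReal.ofReal c⁻¹ * δ₁)) ^ (1 / 2 : ℝ)
        = (8 * δ₁) * ((8 * δ₁) ^ (1 / 2 : ℝ) *
            (ENNReal.ofReal T * (8 * ENNReal.ofReal c⁻¹ * δ₁)) ^ (1 / 2 : ℝ)) := by ring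
      _ = (8 * δ₁) * (8 * θ * (δ₁ * δ₁) ^ (1 / 2 : ℝ)) := by rw [sqrt_bookkeeping, hθ]
      _ = 64 * θ * δ₁ ^ 2 := by rw [rpow_half_mul_self']; ring
  have hI₂' : (8 * δ₂) ^ (1 / 2 : ℝ) * (8 * δ₁) *
      (ENNReal.ofReal T * (8 * ENNReal.ofReal c⁻¹ * δ₂)) ^ (1 / 2 : ℝ) = 64 * θ * δ₁ * δ₂ := by
    calc (8 * δ₂) ^ (1 / 2 : ℝ) * (8 * δ₁) * (ENNReal.ofReal T * (8 * ENNReal.ofReal c⁻¹ * δ₂)) ^ (1 / 2 : ℝ)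
        = (8 * δ₁) * ((8 * δ₂) ^ (1 / 2 : ℝ) *
            (ENNReal.ofReal T * (8 * ENNReal.ofReal c⁻¹ * δ₂)) ^ (1 / 2 : ℝ)) := by ring
      _ = (8 * δ₁) * (8 * θ * (δ₂ * δ₂) ^ (1 / 2 : ℝ)) := by rw [sqrt_bookkeeping, hθ]
      _ = 64 * θ * δ₁ * δ₂ := by rw [rpow_half_mul_self']; ring
  have hcinv : ENNReal.ofReal (1 / (2 * c)) ≤ ENNReal.ofReal c⁻¹ :=
    ENNReal.ofReal_le_ofReal (by rw [one_div]; exact inv_anti₀ hc (by linarith))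
  have hc2 : ENNReal.ofReal (c⁻¹ ^ 2) = ENNReal.ofReal c⁻¹ * ENNReal.ofReal c⁻¹ := by
    rw [sq, ENNReal.ofReal_mul (inv_nonneg.2 hc.le)]
  have h1c : ENNReal.ofReal (1 / c) = ENNReal.ofReal c⁻¹ := by rw [one_div]
  -- the key smallness consequences
  have hX₁ : 36 * ENNReal.ofReal (1 / (2 * c)) * (4 * C ^ 2 * K3 ^ 2 * (64 * θ * δ₁ ^ 2)) ≤ δ₁ :=
    calc 36 * ENNReal.ofReal (1 / (2 * c)) * (4 * C ^ 2 * K3 ^ 2 * (64 * θ * δ₁ ^ 2))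
        ≤ 36 * ENNReal.ofReal c⁻¹ * (4 * C ^ 2 * K3 ^ 2 * (64 * θ * δ₁ ^ 2)) :=
          mul_le_mul' (mul_le_mul' le_rfl hcinv) le_rfl
      _ = 9216 * κ * δ₁ := by rw [hκ]; ring
      _ ≤ 36864 * κ * δ₁ := mul_le_mul' (mul_le_mul' (by norm_num) le_rfl) le_rfl
      _ ≤ 1 * δ₁ := mul_le_mul' hs' le_rfl
      _ = δ₁ := one_mul _
  have hY₁ : 36 * ENNReal.ofReal (c⁻¹ ^ 2) * (4 * C ^ 2 * K3 ^ 2 * (64 * θ * δ₁ ^ 2)) ≤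
      ENNReal.ofReal c⁻¹ * δ₁ :=
    calc 36 * ENNReal.ofReal (c⁻¹ ^ 2) * (4 * C ^ 2 * K3 ^ 2 * (64 * θ * δ₁ ^ 2))
        = ENNReal.ofReal c⁻¹ * (9216 * κ * δ₁) := by rw [hc2, hκ]; ring
      _ ≤ ENNReal.ofReal c⁻¹ * (36864 * κ * δ₁) :=
          mul_le_mul' le_rfl (mul_le_mul' (mul_le_mul' (by norm_num) le_rfl) le_rfl)
      _ ≤ ENNReal.ofReal c⁻¹ * (1 * δ₁) := mul_le_mul' le_rfl (mul_le_mul' hs' le_rfl)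
      _ = ENNReal.ofReal c⁻¹ * δ₁ := by rw [one_mul]
  have hX₂ : 36 * ENNReal.ofReal (1 / (2 * c)) * (16 * C ^ 2 * K3 ^ 2 * (64 * θ * δ₁ * δ₂)) ≤ δ₂ :=
    calc 36 * ENNReal.ofReal (1 / (2 * c)) * (16 * C ^ 2 * K3 ^ 2 * (64 * θ * δ₁ * δ₂))
        ≤ 36 * ENNReal.ofReal c⁻¹ * (16 * C ^ 2 * K3 ^ 2 * (64 * θ * δ₁ * δ₂)) :=
          mul_le_mul' (mul_le_mul' le_rfl hcinv) le_rfl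
      _ = 36864 * κ * δ₂ := by rw [hκ]; ring
      _ ≤ 1 * δ₂ := mul_le_mul' hs' le_rfl
      _ = δ₂ := one_mul _
  have hY₂ : 36 * ENNReal.ofReal (c⁻¹ ^ 2) * (16 * C ^ 2 * K3 ^ 2 * (64 * θ * δ₁ * δ₂)) ≤
      ENNReal.ofReal c⁻¹ * δ₂ :=
    calc 36 * ENNReal.ofReal (c⁻¹ ^ 2) * (16 * C ^ 2 * K3 ^ 2 * (64 * θ * δ₁ * δ₂))
        = ENNReal.ofReal c⁻¹ * (36864 * κ * δ₂) := by rw [hc2, hκ]; ring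
      _ ≤ ENNReal.ofReal c⁻¹ * (1 * δ₂) := mul_le_mul' le_rfl (mul_le_mul' hs' le_rfl)
      _ = ENNReal.ofReal c⁻¹ * δ₂ := by rw [one_mul]
  have h8 : ∀ x : ℝ≥0∞, 7 * x ≤ 8 * x := fun x => mul_le_mul' (by norm_num) le_rfl
  have h8c : ∀ x : ℝ≥0∞, 5 * (ENNReal.ofReal c⁻¹ * x) ≤ 8 * ENNReal.ofReal c⁻¹ * x := fun x => by
    rw [mul_assoc]; exact mul_le_mul' (by norm_num) le_rfl
  refine ⟨fun t ht => ?_, ?_, fun t ht => ?_, ?_⟩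
  · calc _ ≤ _ := hSA t ht
      _ ≤ 2 * (2 * α₁ + 18 * ENNReal.ofReal (1 / (2 * c)) * (4 * C ^ 2 * K3 ^ 2 * (64 * θ * δ₁ ^ 2))) +
          2 * δ₁ := by
          refine add_le_add (mul_le_mul' le_rfl ?_) (mul_le_mul' le_rfl (hF₁ t ht))
          calc _ ≤ _ := hTA t ht
            _ = _ := by rw [hI₁']
      _ = 4 * α₁ + 36 * ENNReal.ofReal (1 / (2 * c)) * (4 * C ^ 2 * K3 ^ 2 * (64 * θ * δ₁ ^ 2)) +
          2 * δ₁ := by ring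
      _ ≤ 4 * δ₁ + δ₁ + 2 * δ₁ := add_le_add (add_le_add (mul_le_mul' le_rfl hα₁) hX₁) le_rfl
      _ = 7 * δ₁ := by ring
      _ ≤ 8 * δ₁ := h8 _
  · calc _ ≤ _ := hSP
      _ ≤ 2 * (ENNReal.ofReal c⁻¹ * α₁ +
            18 * ENNReal.ofReal (c⁻¹ ^ 2) * (4 * C ^ 2 * K3 ^ 2 * (64 * θ * δ₁ ^ 2))) +
          2 * (ENNReal.ofReal c⁻¹ * δ₁) := by
          refine add_le_add (mul_le_mul' le_rfl ?_) (mul_le_mul' le_rfl hG₁)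
          calc _ ≤ _ := hTP
            _ = _ := by rw [hI₁', h1c]
      _ = 2 * (ENNReal.ofReal c⁻¹ * α₁) +
          36 * ENNReal.ofReal (c⁻¹ ^ 2) * (4 * C ^ 2 * K3 ^ 2 * (64 * θ * δ₁ ^ 2)) +
          2 * (ENNReal.ofReal c⁻¹ * δ₁) := by ring
      _ ≤ 2 * (ENNReal.ofReal c⁻¹ * δ₁) + ENNReal.ofReal c⁻¹ * δ₁ + 2 * (ENNReal.ofReal c⁻¹ * δ₁) :=
          add_le_add (add_le_add (mul_le_mul' le_rfl (mul_le_mul' le_rfl hα₁)) hY₁) le_rfl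
      _ = 5 * (ENNReal.ofReal c⁻¹ * δ₁) := by ring
      _ ≤ 8 * ENNReal.ofReal c⁻¹ * δ₁ := h8c _
  · calc _ ≤ _ := hSB t ht
      _ ≤ 2 * (2 * α₂ + 18 * ENNReal.ofReal (1 / (2 * c)) * (16 * C ^ 2 * K3 ^ 2 * (64 * θ * δ₁ * δ₂))) +
          2 * δ₂ := by
          refine add_le_add (mul_le_mul' le_rfl ?_) (mul_le_mul' le_rfl (hF₂ t ht))
          calc _ ≤ _ := hTB t ht
            _ = _ := by rw [hI₂']
      _ = 4 * α₂ + 36 * ENNReal.ofReal (1 / (2 * c)) * (16 * C ^ 2 * K3 ^ 2 * (64 * θ * δ₁ * δ₂)) +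
          2 * δ₂ := by ring
      _ ≤ 4 * δ₂ + δ₂ + 2 * δ₂ := add_le_add (add_le_add (mul_le_mul' le_rfl hα₂) hX₂) le_rfl
      _ = 7 * δ₂ := by ring
      _ ≤ 8 * δ₂ := h8 _
  · calc _ ≤ _ := hSE
      _ ≤ 2 * (ENNReal.ofReal c⁻¹ * α₂ +
            18 * ENNReal.ofReal (c⁻¹ ^ 2) * (16 * C ^ 2 * K3 ^ 2 * (64 * θ * δ₁ * δ₂))) +
          2 * (ENNReal.ofReal c⁻¹ * δ₂) := by
          refine add_le_add (mul_le_mul' le_rfl ?_) (mul_le_mul' le_rfl hG₂)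
          calc _ ≤ _ := hTE
            _ = _ := by rw [hI₂', h1c]
      _ = 2 * (ENNReal.ofReal c⁻¹ * α₂) +
          36 * ENNReal.ofReal (c⁻¹ ^ 2) * (16 * C ^ 2 * K3 ^ 2 * (64 * θ * δ₁ * δ₂)) +
          2 * (ENNReal.ofReal c⁻¹ * δ₂) := by ring
      _ ≤ 2 * (ENNReal.ofReal c⁻¹ * δ₂) + ENNReal.ofReal c⁻¹ * δ₂ + 2 * (ENNReal.ofReal c⁻¹ * δ₂) :=
          add_le_add (add_le_add (mul_le_mul' le_rfl (mul_le_mul' le_rfl hα₂)) hY₂) le_rfl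
      _ = 5 * (ENNReal.ofReal c⁻¹ * δ₂) := by ring
      _ ≤ 8 * ENNReal.ofReal c⁻¹ * δ₂ := h8c _

/-- **The induction step of Tao's `X¹/X²` contraction bounds WITH FORCE (Fourier side).** Let
`c > 0`, `T ≥ 0`, `a` a measurable datum with all weighted square moments finite, `E` of the
class, `v = h − E` (the current forced iterate) and `F = forcing c T b`. Let `δ₁, δ₂` dominate the datum moments (`α_k = ∫⁻(‖η‖ᵏ∑ⱼ‖aⱼ‖ₑ)² ≤ δ_k`) and the
forcing moments (`sup_{[0,T]}∫⁻(‖η‖ᵏM_F)² ≤ δ_k`, `∫₀ᵀ∫⁻(‖η‖^{k+1}M_F)² ≤ c⁻¹δ_k`, `k = 1, 2`), assume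
the smallness condition `36864 C_N²K₃² c⁻¹ (T c⁻¹)^{1/2} δ₁ ≤ 1` and the four bounds

  `sup_{[0,T]}∫⁻(‖η‖M_v)² ≤ 8δ₁`, `∫₀ᵀ∫⁻(‖η‖²M_v)² ≤ 8c⁻¹δ₁`,
  `sup_{[0,T]}∫⁻(‖η‖²M_v)² ≤ 8δ₂`, `∫₀ᵀ∫⁻(‖η‖³M_v)² ≤ 8c⁻¹δ₂`.

Then the next forced iterate `w' = (h − duhamelIntegral c T v) + F` obeys the same four bounds
(`I₁ ≤ 256C_N²K₃²(Tc⁻¹)^{1/2}δ₁²`, `I₂ ≤ 1024C_N²K₃²(Tc⁻¹)^{1/2}δ₁δ₂`, the transfer bounds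
`2α + 18(2c)⁻¹I`, `c⁻¹α + 18c⁻²I` of the homogeneous chain and the splits against `F`). This is the
ball-preservation half of the contraction argument of the proof of Thm. 5.1 (arXiv Thm. 28, p. 16)
for the Duhamel map WITH force, levels 1 and 2.
[cite: Tao2011, Thm. 5.4 (ii) (arXiv Thm. 31); proof of Thm. 5.1 (arXiv Thm. 28, p. 16); Lemma 2.1 (arXiv Lemma 23)] -/
theorem picard_step_bounds_forced (hc : 0 < c) (hT : 0 ≤ T) (ha : AEStronglyMeasurable a volume)
    (haw : ∀ (k : ℕ) j, ∫⁻ η, (ENNReal.ofReal ((1 + ‖η‖) ^ k) * ‖a η j‖ₑ) ^ 2 < ⊤)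
    (hEc : Continuous (uncurry E)) (hEd : ∀ K : ℕ, ∃ B : ℝ, ∀ t, HasDecay K B (E t))
    {δ₁ δ₂ : ℝ≥0∞}
    (hα₁ : ∫⁻ η, (ENNReal.ofReal ‖η‖ * ∑ j, ‖a η j‖ₑ) ^ 2 ≤ δ₁)
    (hα₂ : ∫⁻ η, (ENNReal.ofReal (‖η‖ ^ 2) * ∑ j, ‖a η j‖ₑ) ^ 2 ≤ δ₂)
    (hF₁ : ∀ t ∈ Icc 0 T, ∫⁻ η, (ENNReal.ofReal ‖η‖ * ∑ j, ‖forcing c T b t η j‖ₑ) ^ 2 ≤ δ₁)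
    (hG₁ : ∫⁻ t in Ioc 0 T, ∫⁻ η, (ENNReal.ofReal (‖η‖ ^ 2) *
      ∑ j, ‖forcing c T b t η j‖ₑ) ^ 2 ≤ ENNReal.ofReal c⁻¹ * δ₁)
    (hF₂ : ∀ t ∈ Icc 0 T, ∫⁻ η, (ENNReal.ofReal (‖η‖ ^ 2) * ∑ j, ‖forcing c T b t η j‖ₑ) ^ 2 ≤ δ₂)
    (hG₂ : ∫⁻ t in Ioc 0 T, ∫⁻ η, (ENNReal.ofReal (‖η‖ ^ 3) *
      ∑ j, ‖forcing c T b t η j‖ₑ) ^ 2 ≤ ENNReal.ofReal c⁻¹ * δ₂)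
    (hs : 36864 * (ENNReal.ofReal (4 * π) * (Fintype.card (Fin 3) : ℝ≥0∞) ^ 2) ^ 2 *
        ((SNormLESNormFDerivOfEqConst ℂ (volume : Measure (EuclideanSpace ℝ (Fin 3))) 2 *
          ENNReal.ofReal (2 * π)) ^ (3 / 2 : ℝ)) ^ 2 * ENNReal.ofReal c⁻¹ *
        (ENNReal.ofReal T * ENNReal.ofReal c⁻¹) ^ (1 / 2 : ℝ) * δ₁ ≤ 1)
    (hA : ∀ s ∈ Icc 0 T, ∫⁻ η, (ENNReal.ofReal ‖η‖ *
      ∑ j, ‖(heat c η (clamp T s) • a η - E s η) j‖ₑ) ^ 2 ≤ 8 * δ₁)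
    (hP : ∫⁻ s in Ioc 0 T, ∫⁻ η, (ENNReal.ofReal (‖η‖ ^ 2) *
      ∑ j, ‖(heat c η (clamp T s) • a η - E s η) j‖ₑ) ^ 2 ≤ 8 * ENNReal.ofReal c⁻¹ * δ₁)
    (hB : ∀ s ∈ Icc 0 T, ∫⁻ η, (ENNReal.ofReal (‖η‖ ^ 2) *
      ∑ j, ‖(heat c η (clamp T s) • a η - E s η) j‖ₑ) ^ 2 ≤ 8 * δ₂)
    (hE : ∫⁻ s in Ioc 0 T, ∫⁻ η, (ENNReal.ofReal (‖η‖ ^ 3) *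
      ∑ j, ‖(heat c η (clamp T s) • a η - E s η) j‖ₑ) ^ 2 ≤ 8 * ENNReal.ofReal c⁻¹ * δ₂) :
    (∀ t ∈ Icc 0 T, ∫⁻ η, (ENNReal.ofReal ‖η‖ * ∑ j, ‖((heat c η (clamp T t) • a η -
        duhamelIntegral c T (fun s ζ => heat c ζ (clamp T s) • a ζ - E s ζ) t η) +
        forcing c T b t η) j‖ₑ) ^ 2 ≤ 8 * δ₁) ∧
    (∫⁻ t in Ioc 0 T, ∫⁻ η, (ENNReal.ofReal (‖η‖ ^ 2) * ∑ j, ‖((heat c η (clamp T t) • a η -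
        duhamelIntegral c T (fun s ζ => heat c ζ (clamp T s) • a ζ - E s ζ) t η) +
        forcing c T b t η) j‖ₑ) ^ 2 ≤ 8 * ENNReal.ofReal c⁻¹ * δ₁) ∧
    (∀ t ∈ Icc 0 T, ∫⁻ η, (ENNReal.ofReal (‖η‖ ^ 2) * ∑ j, ‖((heat c η (clamp T t) • a η -
        duhamelIntegral c T (fun s ζ => heat c ζ (clamp T s) • a ζ - E s ζ) t η) +
        forcing c T b t η) j‖ₑ) ^ 2 ≤ 8 * δ₂) ∧
    (∫⁻ t in Ioc 0 T, ∫⁻ η, (ENNReal.ofReal (‖η‖ ^ 3) * ∑ j, ‖((heat c η (clamp T t) • a η -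
        duhamelIntegral c T (fun s ζ => heat c ζ (clamp T s) • a ζ - E s ζ) t η) +
        forcing c T b t η) j‖ₑ) ^ 2 ≤ 8 * ENNReal.ofReal c⁻¹ * δ₂) :=
  picard_step_bounds_forced' hc hT ha haw hEc.measurable (fun η => hEc.uncurry_right η) hEd hα₁ hα₂ hF₁ hG₁ hF₂ hG₂ hs hA hP hB hE

/-- Joint measurability of the free evolution `(s, η) ↦ heat(clamp s) • a η`. [folklore] -/
private theorem aestronglyMeasurable_uncurry_heat_smul' (ha : AEStronglyMeasurable a volume) :
    AEStronglyMeasurable (uncurry fun (s : ℝ) (η : EuclideanSpace ℝ (Fin 3)) => heat c η (clamp T s) • a η)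
      (volume.prod volume) := by
  have h := aestronglyMeasurable_uncurry_hsub c T a (fun _ _ => 0) ha continuous_const
  simpa using h

/-- **Tao 2013, Thm. 5.4 (ii) WITH FORCE — the forced Picard iterates stay in the ball (Fourier
side, levels 1 and 2).** Let `c > 0`, `T ≥ 0`, `a` a measurable datum with all weighted square
moments finite, `b` force coefficients jointly continuous with pointwise decay of every order
uniformly in time, and let `δ₁, δ₂` dominate the datum moments `α₁ = ∫⁻(‖η‖∑ⱼ‖aⱼ‖ₑ)²`,
`α₂ = ∫⁻(‖η‖²∑ⱼ‖aⱼ‖ₑ)²` and the forcing moments of `F = forcing c T b`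
(`sup_{[0,T]}∫⁻(‖η‖ᵏM_F)² ≤ δ_k`, `∫₀ᵀ∫⁻(‖η‖^{k+1}M_F)² ≤ c⁻¹δ_k`, `k = 1, 2`; by
`ForcedFourierDuhamelForcing` these are `≲ T²‖∇ᵏf‖²_{L^∞_tL²_x}`). Under the smallness condition

  `36864 · C_N²K₃² · c⁻¹ (T c⁻¹)^{1/2} · δ₁ ≤ 1`   (`T δ₁² ≤ c₀ c³`, i.e. Tao's
  `(‖u₀‖_{H¹} + ‖f‖_{L¹_tH¹_x})⁴ T ≤ c` at `ν = 1`, after rescaling),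

every forced Picard iterate `w_n = picardIterForced c T a b n`, `M_n(s) = ∑ⱼ‖w_n(s)ⱼ‖ₑ`, obeys

  `sup_{s∈[0,T]}∫⁻(‖η‖M_n(s))² ≤ 8δ₁`, `∫₀ᵀ∫⁻(‖η‖²M_n(s))² ≤ 8c⁻¹δ₁`,
  `sup_{s∈[0,T]}∫⁻(‖η‖²M_n(s))² ≤ 8δ₂`, `∫₀ᵀ∫⁻(‖η‖³M_n(s))² ≤ 8c⁻¹δ₂`

(`‖w_n‖_{X¹} ≲ ‖u₀‖_{Ḣ¹} + ‖f‖_{L¹_tḢ¹_x}`, `‖w_n‖_{X²}` linearly, uniformly in `n`).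
[cite: Tao2011, Thm. 5.4 (ii) (arXiv Thm. 31, p. 18); proof of Thm. 5.1 (arXiv Thm. 28, p. 16)]
Twin for the wide (jointly measurable, time-continuous at each frequency) class of `E`. -/
theorem picard_uniform_bounds_forced' (hc : 0 < c) (hT : 0 ≤ T) (ha : AEStronglyMeasurable a volume)
    (haw : ∀ (k : ℕ) j, ∫⁻ η, (ENNReal.ofReal ((1 + ‖η‖) ^ k) * ‖a η j‖ₑ) ^ 2 < ⊤)
    (hbm : Measurable (uncurry b)) (hbt : ∀ ξ, Continuous fun s => b s ξ) (hbd : ∀ K : ℕ, ∃ B : ℝ, ∀ s, HasDecay K B (b s))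
    {δ₁ δ₂ : ℝ≥0∞}
    (hα₁ : ∫⁻ η, (ENNReal.ofReal ‖η‖ * ∑ j, ‖a η j‖ₑ) ^ 2 ≤ δ₁)
    (hα₂ : ∫⁻ η, (ENNReal.ofReal (‖η‖ ^ 2) * ∑ j, ‖a η j‖ₑ) ^ 2 ≤ δ₂)
    (hF₁ : ∀ t ∈ Icc 0 T, ∫⁻ η, (ENNReal.ofReal ‖η‖ * ∑ j, ‖forcing c T b t η j‖ₑ) ^ 2 ≤ δ₁)
    (hG₁ : ∫⁻ t in Ioc 0 T, ∫⁻ η, (ENNReal.ofReal (‖η‖ ^ 2) *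
      ∑ j, ‖forcing c T b t η j‖ₑ) ^ 2 ≤ ENNReal.ofReal c⁻¹ * δ₁)
    (hF₂ : ∀ t ∈ Icc 0 T, ∫⁻ η, (ENNReal.ofReal (‖η‖ ^ 2) * ∑ j, ‖forcing c T b t η j‖ₑ) ^ 2 ≤ δ₂)
    (hG₂ : ∫⁻ t in Ioc 0 T, ∫⁻ η, (ENNReal.ofReal (‖η‖ ^ 3) *
      ∑ j, ‖forcing c T b t η j‖ₑ) ^ 2 ≤ ENNReal.ofReal c⁻¹ * δ₂)
    (hs : 36864 * (ENNReal.ofReal (4 * π) * (Fintype.card (Fin 3) : ℝ≥0∞) ^ 2) ^ 2 *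
        ((SNormLESNormFDerivOfEqConst ℂ (volume : Measure (EuclideanSpace ℝ (Fin 3))) 2 *
          ENNReal.ofReal (2 * π)) ^ (3 / 2 : ℝ)) ^ 2 * ENNReal.ofReal c⁻¹ *
        (ENNReal.ofReal T * ENNReal.ofReal c⁻¹) ^ (1 / 2 : ℝ) * δ₁ ≤ 1) (n : ℕ) :
    (∀ t ∈ Icc 0 T, ∫⁻ η, (ENNReal.ofReal ‖η‖ * ∑ j, ‖picardIterForced c T a b n t η j‖ₑ) ^ 2 ≤
        8 * δ₁) ∧
    (∫⁻ t in Ioc 0 T, ∫⁻ η, (ENNReal.ofReal (‖η‖ ^ 2) *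
        ∑ j, ‖picardIterForced c T a b n t η j‖ₑ) ^ 2 ≤ 8 * ENNReal.ofReal c⁻¹ * δ₁) ∧
    (∀ t ∈ Icc 0 T, ∫⁻ η, (ENNReal.ofReal (‖η‖ ^ 2) *
        ∑ j, ‖picardIterForced c T a b n t η j‖ₑ) ^ 2 ≤ 8 * δ₂) ∧
    (∫⁻ t in Ioc 0 T, ∫⁻ η, (ENNReal.ofReal (‖η‖ ^ 3) *
        ∑ j, ‖picardIterForced c T a b n t η j‖ₑ) ^ 2 ≤ 8 * ENNReal.ofReal c⁻¹ * δ₂) := by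
  induction n with
  | zero =>
    -- `w₀ = heat • a + F`
    have h0 : picardIterForced c T a b 0 = fun t ξ => heat c ξ (clamp T t) • a ξ + forcing c T b t ξ :=
      picardIterForced_zero c T a b
    have hhs : ∀ t, AEStronglyMeasurable (fun η : EuclideanSpace ℝ (Fin 3) =>
        heat c η (clamp T t) • a η) volume := fun t => aestronglyMeasurable_heat_smul ha t
    have hhj := aestronglyMeasurable_uncurry_heat_smul' (c := c) (T := T) ha
    have hW1 : Measurable fun η : EuclideanSpace ℝ (Fin 3) => ENNReal.ofReal ‖η‖ :=
      (ENNReal.continuous_ofReal.comp continuous_norm).measurable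
    have hWk : ∀ k : ℕ, Measurable fun η : EuclideanSpace ℝ (Fin 3) => ENNReal.ofReal (‖η‖ ^ k) :=
      fun k => (ENNReal.continuous_ofReal.comp (continuous_norm.pow k)).measurable
    have hcc : 2 * ENNReal.ofReal (1 / (2 * c)) = ENNReal.ofReal c⁻¹ := by
      rw [← ENNReal.ofReal_ofNat, ← ENNReal.ofReal_mul (by norm_num)]
      congr 1; field_simp
    have h48 : ∀ x : ℝ≥0∞, 2 * x + 2 * x ≤ 8 * x := fun x => by
      rw [← add_mul]; exact mul_le_mul' (by norm_num) le_rfl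
    have h38 : ∀ x : ℝ≥0∞, ENNReal.ofReal c⁻¹ * x + 2 * (ENNReal.ofReal c⁻¹ * x) ≤
        8 * ENNReal.ofReal c⁻¹ * x := fun x => by
      calc ENNReal.ofReal c⁻¹ * x + 2 * (ENNReal.ofReal c⁻¹ * x) = 3 * (ENNReal.ofReal c⁻¹ * x) := by ring
        _ ≤ 8 * (ENNReal.ofReal c⁻¹ * x) := mul_le_mul' (by norm_num) le_rfl
        _ = _ := by rw [mul_assoc]
    simp only [h0]
    refine ⟨fun t ht => ?_, ?_, fun t ht => ?_, ?_⟩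
    · calc _ ≤ _ := lintegral_weight_majorant_add_sq_le (g := forcing c T b t) (hhs t) hW1
        _ ≤ 2 * δ₁ + 2 * δ₁ := add_le_add
            (mul_le_mul' le_rfl ((lintegral_weight_majorant_heat_sq_le hc.le _ t).trans hα₁))
            (mul_le_mul' le_rfl (hF₁ t ht))
        _ ≤ 8 * δ₁ := h48 _
    · calc _ ≤ _ := lintegral_time_weight_majorant_add_sq_le (T := T) (g := forcing c T b) hhj hhs (hWk 2)
        _ ≤ 2 * (ENNReal.ofReal (1 / (2 * c)) * δ₁) + 2 * (ENNReal.ofReal c⁻¹ * δ₁) := by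
            refine add_le_add (mul_le_mul' le_rfl ?_) (mul_le_mul' le_rfl hG₁)
            have h := lintegral_time_weight_majorant_heat_sq_le (T := T) (a := a) hc hT ha 0
            simp only [zero_add, pow_one] at h
            exact h.trans (mul_le_mul' le_rfl hα₁)
        _ = ENNReal.ofReal c⁻¹ * δ₁ + 2 * (ENNReal.ofReal c⁻¹ * δ₁) := by rw [← mul_assoc, hcc]
        _ ≤ 8 * ENNReal.ofReal c⁻¹ * δ₁ := h38 _
    · calc _ ≤ _ := lintegral_weight_majorant_add_sq_le (g := forcing c T b t) (hhs t) (hWk 2)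
        _ ≤ 2 * δ₂ + 2 * δ₂ := add_le_add
            (mul_le_mul' le_rfl ((lintegral_weight_majorant_heat_sq_le hc.le _ t).trans hα₂))
            (mul_le_mul' le_rfl (hF₂ t ht))
        _ ≤ 8 * δ₂ := h48 _
    · calc _ ≤ _ := lintegral_time_weight_majorant_add_sq_le (T := T) (g := forcing c T b) hhj hhs (hWk 3)
        _ ≤ 2 * (ENNReal.ofReal (1 / (2 * c)) * δ₂) + 2 * (ENNReal.ofReal c⁻¹ * δ₂) := by
            refine add_le_add (mul_le_mul' le_rfl ?_) (mul_le_mul' le_rfl hG₂)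
            have h := lintegral_time_weight_majorant_heat_sq_le (T := T) (a := a) hc hT ha 1
            exact h.trans (mul_le_mul' le_rfl hα₂)
        _ = ENNReal.ofReal c⁻¹ * δ₂ + 2 * (ENNReal.ofReal c⁻¹ * δ₂) := by rw [← mul_assoc, hcc]
        _ ≤ 8 * ENNReal.ofReal c⁻¹ * δ₂ := h38 _
  | succ n ih =>
    set En : ℝ → EuclideanSpace ℝ (Fin 3) → Fin 3 → ℂ :=
      fun t ξ => heat c ξ (clamp T t) • a ξ - picardIterForced c T a b n t ξ with hEn
    have hvn : (fun s η => heat c η (clamp T s) • a η - En s η) = picardIterForced c T a b n := by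
      funext s η; simp [hEn]
    have hstep : picardIterForced c T a b (n + 1) = fun t η => (heat c η (clamp T t) • a η -
        duhamelIntegral c T (fun s ζ => heat c ζ (clamp T s) • a ζ - En s ζ) t η) +
        forcing c T b t η := by
      funext t η
      rw [hvn, picardIterForced_succ, duhamelForced_eq_sub]
      abel
    obtain ⟨-, hEm, hEt, hEd⟩ := class_picardIterForced' hc.le hT ha haw hbm hbt hbd n
    obtain ⟨hA, hP, hB, hE⟩ := ih
    have hA' : ∀ s ∈ Icc 0 T, ∫⁻ η, (ENNReal.ofReal ‖η‖ *
        ∑ j, ‖(heat c η (clamp T s) • a η - En s η) j‖ₑ) ^ 2 ≤ 8 * δ₁ := fun s hs => by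
      simpa only [hEn, sub_sub_cancel] using hA s hs
    have hP' : ∫⁻ s in Ioc 0 T, ∫⁻ η, (ENNReal.ofReal (‖η‖ ^ 2) *
        ∑ j, ‖(heat c η (clamp T s) • a η - En s η) j‖ₑ) ^ 2 ≤ 8 * ENNReal.ofReal c⁻¹ * δ₁ := by
      simpa only [hEn, sub_sub_cancel] using hP
    have hB' : ∀ s ∈ Icc 0 T, ∫⁻ η, (ENNReal.ofReal (‖η‖ ^ 2) *
        ∑ j, ‖(heat c η (clamp T s) • a η - En s η) j‖ₑ) ^ 2 ≤ 8 * δ₂ := fun s hs => by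
      simpa only [hEn, sub_sub_cancel] using hB s hs
    have hE' : ∫⁻ s in Ioc 0 T, ∫⁻ η, (ENNReal.ofReal (‖η‖ ^ 3) *
        ∑ j, ‖(heat c η (clamp T s) • a η - En s η) j‖ₑ) ^ 2 ≤ 8 * ENNReal.ofReal c⁻¹ * δ₂ := by
      simpa only [hEn, sub_sub_cancel] using hE
    have h := picard_step_bounds_forced' hc hT ha haw hEm hEt hEd hα₁ hα₂ hF₁ hG₁ hF₂ hG₂ hs
      hA' hP' hB' hE'
    rw [hstep]
    exact h

/-- **Tao 2013, Thm. 5.4 (ii) WITH FORCE — the forced Picard iterates stay in the ball (Fourier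
side, levels 1 and 2).** Let `c > 0`, `T ≥ 0`, `a` a measurable datum with all weighted square
moments finite, `b` force coefficients jointly continuous with pointwise decay of every order
uniformly in time, and let `δ₁, δ₂` dominate the datum moments `α₁ = ∫⁻(‖η‖∑ⱼ‖aⱼ‖ₑ)²`,
`α₂ = ∫⁻(‖η‖²∑ⱼ‖aⱼ‖ₑ)²` and the forcing moments of `F = forcing c T b`
(`sup_{[0,T]}∫⁻(‖η‖ᵏM_F)² ≤ δ_k`, `∫₀ᵀ∫⁻(‖η‖^{k+1}M_F)² ≤ c⁻¹δ_k`, `k = 1, 2`; by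
`ForcedFourierDuhamelForcing` these are `≲ T²‖∇ᵏf‖²_{L^∞_tL²_x}`). Under the smallness condition

  `36864 · C_N²K₃² · c⁻¹ (T c⁻¹)^{1/2} · δ₁ ≤ 1`   (`T δ₁² ≤ c₀ c³`, i.e. Tao's
  `(‖u₀‖_{H¹} + ‖f‖_{L¹_tH¹_x})⁴ T ≤ c` at `ν = 1`, after rescaling),

every forced Picard iterate `w_n = picardIterForced c T a b n`, `M_n(s) = ∑ⱼ‖w_n(s)ⱼ‖ₑ`, obeys

  `sup_{s∈[0,T]}∫⁻(‖η‖M_n(s))² ≤ 8δ₁`, `∫₀ᵀ∫⁻(‖η‖²M_n(s))² ≤ 8c⁻¹δ₁`,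
  `sup_{s∈[0,T]}∫⁻(‖η‖²M_n(s))² ≤ 8δ₂`, `∫₀ᵀ∫⁻(‖η‖³M_n(s))² ≤ 8c⁻¹δ₂`

(`‖w_n‖_{X¹} ≲ ‖u₀‖_{Ḣ¹} + ‖f‖_{L¹_tḢ¹_x}`, `‖w_n‖_{X²}` linearly, uniformly in `n`).
[cite: Tao2011, Thm. 5.4 (ii) (arXiv Thm. 31, p. 18); proof of Thm. 5.1 (arXiv Thm. 28, p. 16)] -/
theorem picard_uniform_bounds_forced (hc : 0 < c) (hT : 0 ≤ T) (ha : AEStronglyMeasurable a volume)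
    (haw : ∀ (k : ℕ) j, ∫⁻ η, (ENNReal.ofReal ((1 + ‖η‖) ^ k) * ‖a η j‖ₑ) ^ 2 < ⊤)
    (hbc : Continuous (uncurry b)) (hbd : ∀ K : ℕ, ∃ B : ℝ, ∀ s, HasDecay K B (b s))
    {δ₁ δ₂ : ℝ≥0∞}
    (hα₁ : ∫⁻ η, (ENNReal.ofReal ‖η‖ * ∑ j, ‖a η j‖ₑ) ^ 2 ≤ δ₁)
    (hα₂ : ∫⁻ η, (ENNReal.ofReal (‖η‖ ^ 2) * ∑ j, ‖a η j‖ₑ) ^ 2 ≤ δ₂)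
    (hF₁ : ∀ t ∈ Icc 0 T, ∫⁻ η, (ENNReal.ofReal ‖η‖ * ∑ j, ‖forcing c T b t η j‖ₑ) ^ 2 ≤ δ₁)
    (hG₁ : ∫⁻ t in Ioc 0 T, ∫⁻ η, (ENNReal.ofReal (‖η‖ ^ 2) *
      ∑ j, ‖forcing c T b t η j‖ₑ) ^ 2 ≤ ENNReal.ofReal c⁻¹ * δ₁)
    (hF₂ : ∀ t ∈ Icc 0 T, ∫⁻ η, (ENNReal.ofReal (‖η‖ ^ 2) * ∑ j, ‖forcing c T b t η j‖ₑ) ^ 2 ≤ δ₂)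
    (hG₂ : ∫⁻ t in Ioc 0 T, ∫⁻ η, (ENNReal.ofReal (‖η‖ ^ 3) *
      ∑ j, ‖forcing c T b t η j‖ₑ) ^ 2 ≤ ENNReal.ofReal c⁻¹ * δ₂)
    (hs : 36864 * (ENNReal.ofReal (4 * π) * (Fintype.card (Fin 3) : ℝ≥0∞) ^ 2) ^ 2 *
        ((SNormLESNormFDerivOfEqConst ℂ (volume : Measure (EuclideanSpace ℝ (Fin 3))) 2 *
          ENNReal.ofReal (2 * π)) ^ (3 / 2 : ℝ)) ^ 2 * ENNReal.ofReal c⁻¹ *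
        (ENNReal.ofReal T * ENNReal.ofReal c⁻¹) ^ (1 / 2 : ℝ) * δ₁ ≤ 1) (n : ℕ) :
    (∀ t ∈ Icc 0 T, ∫⁻ η, (ENNReal.ofReal ‖η‖ * ∑ j, ‖picardIterForced c T a b n t η j‖ₑ) ^ 2 ≤
        8 * δ₁) ∧
    (∫⁻ t in Ioc 0 T, ∫⁻ η, (ENNReal.ofReal (‖η‖ ^ 2) *
        ∑ j, ‖picardIterForced c T a b n t η j‖ₑ) ^ 2 ≤ 8 * ENNReal.ofReal c⁻¹ * δ₁) ∧
    (∀ t ∈ Icc 0 T, ∫⁻ η, (ENNReal.ofReal (‖η‖ ^ 2) *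
        ∑ j, ‖picardIterForced c T a b n t η j‖ₑ) ^ 2 ≤ 8 * δ₂) ∧
    (∫⁻ t in Ioc 0 T, ∫⁻ η, (ENNReal.ofReal (‖η‖ ^ 3) *
        ∑ j, ‖picardIterForced c T a b n t η j‖ₑ) ^ 2 ≤ 8 * ENNReal.ofReal c⁻¹ * δ₂) :=
  picard_uniform_bounds_forced' hc hT ha haw hbc.measurable (fun ξ => hbc.uncurry_right ξ) hbd hα₁ hα₂ hF₁ hG₁ hF₂ hG₂ hs n

end Bounds

end Literature.Analysis.FluidPDE.FourierNS

end
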